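import Summits.HubbardSuperconductivity.HubbardSuperconductivity.Theorems.KLProgrammeKLRegimeTwoPointAssemblyMatsubaraPartitionAllU
import Literature.MathematicalPhysics.QuantumLattice.HubbardThermalTwoPointMatsubaraLimit
import HarnessLib

/-!
# Route `KLProgramme`, crux K3, child 4 `KLRegimeTwoPointAssembly`, stub `stub_asm_matsubara` —
# part G: the TWO-POINT MATSUBARA IDENTIFICATION FOR EVERY COUPLING (the supplier theorem)

Cell gate-hubbard-kl, seat t2 (HOME/t2/MATSUBARA-ALLU-SCOPE.md §2 (g), §3 F6).  The two-point numerator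
`N_M(U) = ∫dμ_{C_M} ψ⁺_{(x⃗ₑ,0)σ}ψ⁻_{(y⃗ₑ,0)σ'} e^{−V_M(U)}` is dominated exactly like the partition function (part F): its order-`n`
Wick matrix has `2n+1` legs on `n+2` points (the two external points at time `0` carry one leg each), the pointwise bound of
part E applies with the appended configuration, and the two external points cost a polynomial factor `(1+(n+2)K₀)²` and a
geometric `(1+2K₀)ⁿ` (`sum_prod_sum_append_le`), absorbed into the radius parameter `r`.

* `norm_gaussExpect_twoPoint_pow_le_allU` — `‖∫dμ_{C_M}ψ⁺ψ⁻Vⁿ‖ ≤ n!·64(1+2K₀)²e^{βr}e^{(βK₀+nε_M)re^{βK₀r}}·(256|U|L²(1+2K₀)/r)ⁿ`;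
* `tendsto_gaussExpect_twoPoint_mul_grassmannExp_allU`, `tendsto_gaussExpect_twoPoint_eq_trace_div_allU`,
  `tendsto_gaussExpect_twoPoint_div_effPartitionFn_allU`;
* **`tendsto_grassmannTwoPoint_eq_hubbardThermalTwoPoint_sub_allU`** — for `L ≥ 3`, `β > 0`, EVERY real `U`, `μ`,
  spins `σ σ'` and sites `x y ∈ ℤ²`:
  `∫dμ_{C_M}ψ⁺_{(x̄,0)σ}ψ⁻_{(ȳ,0)σ'}e^{−V_M(U)} / ∫dμ_{C_M}e^{−V_M(U)} ⟶ hubbardThermalTwoPoint β U (μ+U/2) L x y σ σ' − ½[σ=σ'][x̄=ȳ]`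
  — LITERALLY the tree's `tendsto_grassmannTwoPoint_eq_hubbardThermalTwoPoint_sub` without `3e|U|L²βB² < 1`.
  This is the `stub_asm_matsubara` input of child 4 (`KLRegimeTwoPointAssembly`): at fixed `(L, β)` the finite-frequency
  Grassmann representation identifies the thermal two-point function for every coupling, so K3's order of limits
  (`U` fixed, `L → ∞`) never meets the tree radius `U_*(β, L) → 0`.
-/

namespace Summit.HubbardSuperconductivity.HubbardSuperconductivity.Theorems.MatsubaraAllU

set_option linter.dupNamespace false -- summit = problem name (single-conjunct summit), D-0017

open MeasureTheory Finset Filter Topology Literature.MathematicalPhysics.QuantumLattice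
  Literature.Probability.LatticeModels
open Literature.MathematicalPhysics.QuantumLattice.GrassmannAlgebra
open scoped Nat ComplexOrder

noncomputable section

/-! ### The two external points: injective enumerations and the reduction to the internal cluster sum -/

/-- The barred-leg enumeration of the two-point word is injective. -/
theorem twoPointPlusEnum_injective (n : ℕ) (σ : Fin 2) : Function.Injective (twoPointPlusEnum n σ) := by
  unfold twoPointPlusEnum
  refine Fin.cons_injective_iff.mpr ⟨?_, ?_⟩
  · rintro ⟨m, hm⟩
    have h := congrArg (fun p : Fin (n + 2) × Fin 2 => (p.1 : ℕ)) hm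
    simp only [Fin.val_castAdd, Fin.val_natAdd] at h
    have := (finProdFinEquiv.symm m : Fin n × Fin 2).1.isLt
    omega
  · intro m m' h
    simp only [Prod.mk.injEq] at h
    have h1 : (finProdFinEquiv.symm m : Fin n × Fin 2).1 = (finProdFinEquiv.symm m' : Fin n × Fin 2).1 :=
      Fin.castAdd_injective _ _ h.1
    exact finProdFinEquiv.symm.injective (Prod.ext h1 h.2)

/-- The unbarred-leg enumeration of the two-point word is injective. -/
theorem twoPointMinusEnum_injective (n : ℕ) (σ' : Fin 2) : Function.Injective (twoPointMinusEnum n σ') := by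
  unfold twoPointMinusEnum
  refine Fin.cons_injective_iff.mpr ⟨?_, ?_⟩
  · rintro ⟨m, hm⟩
    have h := congrArg (fun p : Fin (n + 2) × Fin 2 => (p.1 : ℕ)) hm
    simp only [Fin.val_castAdd, Fin.val_natAdd] at h
    have := (finProdFinEquiv.symm m : Fin n × Fin 2).1.isLt
    omega
  · intro m m' h
    simp only [Prod.mk.injEq] at h
    have h1 : (finProdFinEquiv.symm m : Fin n × Fin 2).1 = (finProdFinEquiv.symm m' : Fin n × Fin 2).1 :=
      Fin.castAdd_injective _ _ h.1
    exact finProdFinEquiv.symm.injective (Prod.ext h1 h.2)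

/-- **Reduction of the cluster sum over `n+2` points (two external points at time `0`) to the internal one**:
for `0 ≤ w ≤ K₀`,
`Σ_{T⊆[n+2]} ∏_{a∈T} Σ_{b∈[n+2]} w(τ'_b − τ'_a) ≤ (1+(n+2)K₀)² (1+2K₀)ⁿ Σ_{T⊆[n]} ∏_{a∈T} Σ_{b∈[n]} w(τ_b − τ_a)`,
`τ' = (τ, 0, 0)`. -/
theorem sum_prod_sum_append_le {n : ℕ} (wr : ℝ → ℝ) (hw0 : ∀ u, 0 ≤ wr u) (K₀ : ℝ) (hK : ∀ u, wr u ≤ K₀)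
    (τ : Fin n → ℝ) :
    ∑ T : Finset (Fin (n + 2)), ∏ a ∈ T, ∑ b : Fin (n + 2),
        wr ((Fin.append τ ![(0 : ℝ), 0] : Fin (n + 2) → ℝ) b - (Fin.append τ ![(0 : ℝ), 0] : Fin (n + 2) → ℝ) a) ≤
      (1 + (n + 2 : ℝ) * K₀) ^ 2 * (1 + 2 * K₀) ^ n *
        ∑ T : Finset (Fin n), ∏ a ∈ T, ∑ b : Fin n, wr (τ b - τ a) := by
  classical
  have hK0 : 0 ≤ K₀ := (hw0 0).trans (hK 0)
  set τ' : Fin (n + 2) → ℝ := Fin.append τ ![(0 : ℝ), 0] with hτ'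
  set g' : Fin (n + 2) → ℝ := fun a => ∑ b : Fin (n + 2), wr (τ' b - τ' a) with hg'
  set g : Fin n → ℝ := fun a => ∑ b : Fin n, wr (τ b - τ a) with hg
  have hg0 : ∀ a, 0 ≤ g a := fun a => Finset.sum_nonneg fun b _ => hw0 _
  have hg'0 : ∀ a, 0 ≤ g' a := fun a => Finset.sum_nonneg fun b _ => hw0 _
  have hleft : ∀ a₀ : Fin n, τ' (Fin.castAdd 2 a₀) = τ a₀ := fun a₀ => by simp [hτ']
  -- internal points: `g'(castAdd a₀) ≤ g(a₀) + 2K₀`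
  have hint : ∀ a₀ : Fin n, g' (Fin.castAdd 2 a₀) ≤ g a₀ + 2 * K₀ := by
    intro a₀
    simp only [hg', Fin.sum_univ_add, hleft]
    refine add_le_add le_rfl ?_
    calc ∑ k : Fin 2, wr (τ' (Fin.natAdd n k) - τ a₀) ≤ ∑ _k : Fin 2, K₀ := Finset.sum_le_sum fun k _ => hK _
      _ = 2 * K₀ := by simp [two_mul]
  -- external points: `g'(natAdd k) ≤ (n+2)K₀`
  have hext : ∀ k : Fin 2, g' (Fin.natAdd n k) ≤ (n + 2 : ℝ) * K₀ := by
    intro k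
    calc g' (Fin.natAdd n k) ≤ ∑ _b : Fin (n + 2), K₀ := Finset.sum_le_sum fun b _ => hK _
      _ = (n + 2 : ℝ) * K₀ := by simp
  rw [sum_univ_prod_eq_prod_one_add, sum_univ_prod_eq_prod_one_add, Fin.prod_univ_add]
  have h1 : ∏ a₀ : Fin n, (1 + g' (Fin.castAdd 2 a₀)) ≤ (1 + 2 * K₀) ^ n * ∏ a₀ : Fin n, (1 + g a₀) := by
    calc ∏ a₀ : Fin n, (1 + g' (Fin.castAdd 2 a₀)) ≤ ∏ a₀ : Fin n, ((1 + 2 * K₀) * (1 + g a₀)) :=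
          Finset.prod_le_prod (fun a₀ _ => by linarith [hg'0 (Fin.castAdd 2 a₀)]) fun a₀ _ => by
            nlinarith [hint a₀, hg0 a₀, hK0]
      _ = (1 + 2 * K₀) ^ n * ∏ a₀ : Fin n, (1 + g a₀) := by
          rw [Finset.prod_mul_distrib, Finset.prod_const, Finset.card_univ, Fintype.card_fin]
  have h2 : ∏ k : Fin 2, (1 + g' (Fin.natAdd n k)) ≤ (1 + (n + 2 : ℝ) * K₀) ^ 2 := by
    calc ∏ k : Fin 2, (1 + g' (Fin.natAdd n k)) ≤ ∏ _k : Fin 2, (1 + (n + 2 : ℝ) * K₀) :=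
          Finset.prod_le_prod (fun k _ => by linarith [hg'0 (Fin.natAdd n k)]) fun k _ => by linarith [hext k]
      _ = (1 + (n + 2 : ℝ) * K₀) ^ 2 := by
          rw [Finset.prod_const, Finset.card_univ, Fintype.card_fin]
  have h10 : 0 ≤ ∏ a₀ : Fin n, (1 + g' (Fin.castAdd 2 a₀)) :=
    Finset.prod_nonneg fun a₀ _ => by linarith [hg'0 (Fin.castAdd 2 a₀)]
  calc (∏ a₀ : Fin n, (1 + g' (Fin.castAdd 2 a₀))) * ∏ k : Fin 2, (1 + g' (Fin.natAdd n k))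
      ≤ ((1 + 2 * K₀) ^ n * ∏ a₀ : Fin n, (1 + g a₀)) * (1 + (n + 2 : ℝ) * K₀) ^ 2 :=
        mul_le_mul h1 h2 (Finset.prod_nonneg fun k _ => by linarith [hg'0 (Fin.natAdd n k)])
          (mul_nonneg (pow_nonneg (by linarith) _) (Finset.prod_nonneg fun a₀ _ => by linarith [hg0 a₀]))
    _ = (1 + (n + 2 : ℝ) * K₀) ^ 2 * (1 + 2 * K₀) ^ n * ∏ a₀ : Fin n, (1 + g a₀) := by ring

variable {L : ℕ} [NeZero L]

/-- **M-uniform domination of the two-point moments for every coupling** (equal external times `0`): there are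
`K₀ ≥ 0` and `ε_M ≥ 0`, `ε_M → 0`, with, for all `M, n` and every `r > 0`,
`‖∫dμ_{C_M} ψ⁺ψ⁻ Vⁿ‖ ≤ n! · (64(1+2K₀)² e^{βr} exp((βK₀+nε_M) r e^{βK₀r})) · (256|U|L²(1+2K₀)/r)ⁿ`. -/
theorem norm_gaussExpect_twoPoint_pow_le_allU {β : ℝ} (hβ : 0 < β) (μ U : ℝ) (σ σ' : Fin 2)
    (xe ye : TorusSite 2 L) :
    ∃ (K₀ : ℝ) (ε : ℕ → ℝ), 0 ≤ K₀ ∧ (∀ M, 0 ≤ ε M) ∧ Tendsto ε atTop (𝓝 0) ∧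
      ∀ (M n : ℕ) (r : ℝ), 0 < r →
        ‖gaussExpect ℂ (hubbardCovariance L M β μ 0)
            (positionField L M β 0 σ xe 0 * positionField L M β 1 σ' ye 0 * hubbardInteraction L M β U ^ n)‖ ≤
          (n ! : ℝ) * (64 * (1 + 2 * K₀) ^ 2 * Real.exp (β * r) *
              Real.exp ((β * K₀ + n * ε M) * r * Real.exp (β * K₀ * r))) *
            (256 * |U| * (L : ℝ) ^ 2 * (1 + 2 * K₀) / r) ^ n := by
  classical
  obtain ⟨K₀, wr, hK₀, hwm, hw0, hwK, hwI, hshift, hlim, hkey⟩ := exists_remainderKernel L hβ μ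
  refine ⟨K₀, fun M => ∫ u, wr M u, hK₀, fun M => integral_nonneg fun u => hw0 M u, hlim, ?_⟩
  intro M n r hr
  have hcard : ((Fintype.card (Fin n → TorusSite 2 L) : ℕ) : ℝ) = ((L : ℝ) ^ 2) ^ n := by
    rw [Fintype.card_fun, Fintype.card_fin, Nat.cast_pow, Fintype.card_pi, prod_const, ZMod.card, card_univ,
      Fintype.card_fin, Nat.cast_pow]
  have hfibP : ∀ a : Fin (n + 2), (univ.filter fun i : Fin (n * 2 + 1) => (twoPointPlusEnum n σ i).1 = a).card ≤ 2 :=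
    card_filter_fst_le_two _ (twoPointPlusEnum_injective n σ)
  have hfibQ : ∀ a : Fin (n + 2), (univ.filter fun j : Fin (n * 2 + 1) => (twoPointMinusEnum n σ' j).1 = a).card ≤ 2 :=
    card_filter_fst_le_two _ (twoPointMinusEnum_injective n σ')
  have hI := integral_sum_prod_sum_le (m := n) β hβ.le (wr M) (hwm M) (hw0 M) K₀ (∫ u, wr M u) hK₀
    (integral_nonneg fun u => hw0 M u) (hwK M) (hshift M) r hr
  set Cn : ℝ := (1 + (n + 2 : ℝ) * K₀) ^ 2 * (1 + 2 * K₀) ^ n with hCn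
  have hCn0 : 0 ≤ Cn := by positivity
  have hdet : ∀ xv : Fin n → TorusSite 2 L, ‖∫ τ in Set.Icc (0 : Fin n → ℝ) (fun _ => β),
      (Matrix.of fun i j : Fin (n * 2 + 1) =>
        -((vertexSubMatrix L M β (Fin.append xv ![xe, ye]) (Fin.append τ ![(0 : ℝ), 0])).transpose *
            hubbardCovariance L M β μ 0 *
            vertexSubMatrix L M β (Fin.append xv ![xe, ye]) (Fin.append τ ![(0 : ℝ), 0]))
          ((twoPointPlusEnum n σ i, 0) : VertexLeg (n + 2)) ((twoPointMinusEnum n σ' j, 1) : VertexLeg (n + 2))).det‖ ≤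
      (4 : ℝ) ^ (n * 2 + 1) * 4 ^ (n + 2) * (Cn * ((n ! : ℝ) / r ^ n * Real.exp (β * r) *
        Real.exp ((β * K₀ + n * ∫ u, wr M u) * r * Real.exp (β * K₀ * r)))) := by
    intro xv
    refine (norm_integral_le_of_norm_le (((integrableOn_sum_prod_sum β (wr M) (hwm M) (hw0 M) K₀ (hwK M)).const_mul
      ((4 : ℝ) ^ (n * 2 + 1) * 4 ^ (n + 2) * Cn))) ?_).trans ?_
    · refine (ae_restrict_iff' measurableSet_Icc).2 (ae_of_all _ fun τ hτ => ?_)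
      have hτ' : ∀ a : Fin (n + 2), (Fin.append τ ![(0 : ℝ), 0] : Fin (n + 2) → ℝ) a ∈ Set.Icc (0 : ℝ) β := by
        intro a
        refine Fin.addCases (fun a₀ => ?_) (fun k => ?_) a
        · rw [Fin.append_left]; exact ⟨hτ.1 a₀, hτ.2 a₀⟩
        · rw [Fin.append_right]
          fin_cases k <;> simp [hβ.le]
      refine (norm_det_vertexWick_le_sum_prod hβ μ _ _ hτ' _ _ hfibP hfibQ (wr M) (hw0 M) (hkey M)).trans ?_
      rw [mul_assoc ((4 : ℝ) ^ (n * 2 + 1) * 4 ^ (n + 2)) Cn]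
      exact mul_le_mul_of_nonneg_left (sum_prod_sum_append_le (wr M) (hw0 M) K₀ (hwK M) τ) (by positivity)
    · rw [integral_const_mul, mul_assoc]
      exact mul_le_mul_of_nonneg_left (mul_le_mul_of_nonneg_left hI hCn0) (by positivity)
  have h64 : (4 : ℝ) ^ (n * 2 + 1) * 4 ^ (n + 2) = 64 * 64 ^ n := by
    have h : (64 : ℝ) ^ n = (4 ^ 2) ^ n * 4 ^ n := by rw [← mul_pow]; norm_num
    rw [h, pow_succ, pow_add, mul_comm n 2, pow_mul]
    ring
  have hCn_le : Cn ≤ (1 + 2 * K₀) ^ 2 * 4 ^ n * (1 + 2 * K₀) ^ n := by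
    have h1 : 1 + (n + 2 : ℝ) * K₀ ≤ (1 + 2 * K₀) * ((n : ℝ) + 1) := by nlinarith
    have h2 : ((n : ℝ) + 1) ≤ 2 ^ n := by
      have := Nat.lt_two_pow_self (n := n)
      exact_mod_cast this
    have h3 : (1 + (n + 2 : ℝ) * K₀) ^ 2 ≤ ((1 + 2 * K₀) * 2 ^ n) ^ 2 :=
      pow_le_pow_left₀ (by positivity) (h1.trans (mul_le_mul_of_nonneg_left h2 (by positivity))) 2
    calc Cn = (1 + (n + 2 : ℝ) * K₀) ^ 2 * (1 + 2 * K₀) ^ n := rfl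
      _ ≤ ((1 + 2 * K₀) * 2 ^ n) ^ 2 * (1 + 2 * K₀) ^ n := mul_le_mul_of_nonneg_right h3 (by positivity)
      _ = (1 + 2 * K₀) ^ 2 * 4 ^ n * (1 + 2 * K₀) ^ n := by
          rw [mul_pow, ← pow_mul, mul_comm n 2, pow_mul]; norm_num
  rw [gaussExpect_twoPoint_mul_hubbardInteraction_pow_eq_det hβ, norm_mul, norm_pow, Complex.norm_real,
    Real.norm_eq_abs]
  set E : ℝ := Real.exp (β * r) * Real.exp ((β * K₀ + n * ∫ u, wr M u) * r * Real.exp (β * K₀ * r)) with hE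
  have hE0 : 0 ≤ E := by positivity
  calc |U| ^ n * ‖∑ xv : Fin n → TorusSite 2 L, _‖
      ≤ |U| ^ n * ∑ xv : Fin n → TorusSite 2 L, (4 : ℝ) ^ (n * 2 + 1) * 4 ^ (n + 2) * (Cn * ((n ! : ℝ) / r ^ n *
          Real.exp (β * r) * Real.exp ((β * K₀ + n * ∫ u, wr M u) * r * Real.exp (β * K₀ * r)))) := by
        gcongr
        exact (norm_sum_le _ _).trans (sum_le_sum fun xv _ => hdet xv)
    _ = |U| ^ n * ((L : ℝ) ^ 2) ^ n * (64 * 64 ^ n) * Cn * ((n ! : ℝ) / r ^ n) * E := by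
        rw [sum_const, card_univ, nsmul_eq_mul, hcard, h64, hE]; ring
    _ ≤ |U| ^ n * ((L : ℝ) ^ 2) ^ n * (64 * 64 ^ n) * ((1 + 2 * K₀) ^ 2 * 4 ^ n * (1 + 2 * K₀) ^ n) *
          ((n ! : ℝ) / r ^ n) * E := by
        gcongr
    _ = (n ! : ℝ) * (64 * (1 + 2 * K₀) ^ 2 * E) * (256 * |U| * (L : ℝ) ^ 2 * (1 + 2 * K₀) / r) ^ n := by
        have hr' : r ^ n ≠ 0 := pow_ne_zero _ hr.ne'
        have h256 : (256 : ℝ) ^ n = 64 ^ n * 4 ^ n := by rw [← mul_pow]; norm_num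
        rw [div_pow, mul_pow, mul_pow, mul_pow, h256]
        field_simp
  -- unfold `E`
    _ = (n ! : ℝ) * (64 * (1 + 2 * K₀) ^ 2 * Real.exp (β * r) *
              Real.exp ((β * K₀ + n * ∫ u, wr M u) * r * Real.exp (β * K₀ * r))) *
            (256 * |U| * (L : ℝ) ^ 2 * (1 + 2 * K₀) / r) ^ n := by rw [hE]; ring

/-- **The `M → ∞` limit of the Grassmann two-point numerator for EVERY coupling** (equal external times `0`):
`∫dμ_{C_M} ψ⁺_{xₑσ}ψ⁻_{yₑσ'} e^{−V} ⟶ Σ'_n ((−1)ⁿ/n!) Uⁿ Σ_{x⃗} ∫_{[0,β]ⁿ} det[vertexLimitEntry on the 2n+1 pairs]` — the tree's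
`tendsto_gaussExpect_twoPoint_mul_grassmannExp` WITHOUT `3e|U|L²βB² < 1`. -/
theorem tendsto_gaussExpect_twoPoint_mul_grassmannExp_allU {β : ℝ} (hβ : 0 < β) (μ U : ℝ) (σ σ' : Fin 2)
    (xe ye : TorusSite 2 L) :
    Tendsto (fun M : ℕ => gaussExpect ℂ (hubbardCovariance L M β μ 0)
        (positionField L M β 0 σ xe 0 * positionField L M β 1 σ' ye 0 * grassmannExp (-(hubbardInteraction L M β U))))
      atTop
      (𝓝 (∑' n : ℕ, ((-1 : ℂ) ^ n * ((n ! : ℂ))⁻¹) * ((U : ℂ) ^ n * ∑ x : Fin n → TorusSite 2 L,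
        ∫ τ in Set.Icc (0 : Fin n → ℝ) (fun _ => β),
          (Matrix.of fun i j : Fin (n * 2 + 1) =>
            vertexLimitEntry L β μ ((Fin.append x ![xe, ye] : Fin (n + 2) → TorusSite 2 L) (twoPointPlusEnum n σ i).1)
              ((Fin.append x ![xe, ye] : Fin (n + 2) → TorusSite 2 L) (twoPointMinusEnum n σ' j).1)
              (twoPointPlusEnum n σ i).2 (twoPointMinusEnum n σ' j).2
              ((Fin.append τ ![(0 : ℝ), 0] : Fin (n + 2) → ℝ) (twoPointMinusEnum n σ' j).1 -
                (Fin.append τ ![(0 : ℝ), 0] : Fin (n + 2) → ℝ) (twoPointPlusEnum n σ i).1)).det))) := by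
  obtain ⟨K₀, ε, hK₀, hε0, hεlim, hmom⟩ := norm_gaussExpect_twoPoint_pow_le_allU (L := L) hβ μ U σ σ' xe ye
  set r : ℝ := 512 * |U| * (L : ℝ) ^ 2 * (1 + 2 * K₀) + 1 with hr
  have hr0 : 0 < r := by positivity
  have hratio : 256 * |U| * (L : ℝ) ^ 2 * (1 + 2 * K₀) / r ≤ 1 / 2 := by
    rw [div_le_iff₀ hr0, hr]
    nlinarith [abs_nonneg U, sq_nonneg (L : ℝ), hK₀]
  have hratio0 : 0 ≤ 256 * |U| * (L : ℝ) ^ 2 * (1 + 2 * K₀) / r := by positivity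
  set A : ℝ := r * Real.exp (β * K₀ * r) with hA
  have hA0 : 0 < A := by positivity
  have hev : ∀ᶠ M in atTop, ε M * A ≤ 1 / 4 := by
    have h1 : Tendsto (fun M => ε M * A) atTop (𝓝 (0 * A)) := hεlim.mul_const A
    rw [zero_mul] at h1
    exact (h1.eventually (ge_mem_nhds (by norm_num : (0 : ℝ) < 1 / 4))).mono fun M hM => hM
  set D : ℝ := 64 * (1 + 2 * K₀) ^ 2 * Real.exp (β * r) * Real.exp (β * K₀ * A) with hD
  have hZ : ∀ M : ℕ, gaussExpect ℂ (hubbardCovariance L M β μ 0)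
      (positionField L M β 0 σ xe 0 * positionField L M β 1 σ' ye 0 * grassmannExp (-(hubbardInteraction L M β U))) =
      ∑' n : ℕ, ((-1 : ℂ) ^ n * ((n ! : ℂ))⁻¹) * gaussExpect ℂ (hubbardCovariance L M β μ 0)
        (positionField L M β 0 σ xe 0 * positionField L M β 1 σ' ye 0 * hubbardInteraction L M β U ^ n) := fun M =>
    gaussExpect_mul_grassmannExp_neg_eq_tsum _ _ (constPart_hubbardInteraction L M β U)
  simp_rw [hZ]
  refine tendsto_tsum_of_dominated_convergence (bound := fun n => D * (3 / 4 : ℝ) ^ n) ?_ (fun n => ?_) ?_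
  · exact (summable_geometric_of_lt_one (by norm_num) (by norm_num)).mul_left D
  · exact (tendsto_gaussExpect_twoPoint_mul_hubbardInteraction_pow hβ μ U σ σ' xe ye ⟨le_rfl, hβ⟩ ⟨le_rfl, hβ⟩
      n).const_mul _
  · filter_upwards [hev] with M hM n
    have hεA1 : |ε M * A| ≤ 1 := by
      rw [abs_of_nonneg (mul_nonneg (hε0 M) hA0.le)]; linarith
    have hexp : Real.exp (ε M * A) ≤ 3 / 2 := by
      have h := Real.abs_exp_sub_one_le hεA1
      rw [abs_of_nonneg (mul_nonneg (hε0 M) hA0.le)] at h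
      have h' := (abs_le.mp h).2
      linarith
    rw [norm_mul, norm_mul, norm_pow, norm_neg, norm_one, one_pow, one_mul, norm_inv, Complex.norm_natCast]
    have hfac : (0 : ℝ) < n ! := by exact_mod_cast Nat.factorial_pos n
    have hkey := hmom M n r hr0
    have hsplit : Real.exp ((β * K₀ + n * ε M) * r * Real.exp (β * K₀ * r)) =
        Real.exp (β * K₀ * A) * Real.exp (ε M * A) ^ n := by
      rw [← Real.exp_nat_mul, ← Real.exp_add, hA]
      ring_nf
    calc ((n ! : ℝ))⁻¹ * ‖gaussExpect ℂ (hubbardCovariance L M β μ 0)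
          (positionField L M β 0 σ xe 0 * positionField L M β 1 σ' ye 0 * hubbardInteraction L M β U ^ n)‖
        ≤ ((n ! : ℝ))⁻¹ * ((n ! : ℝ) * (64 * (1 + 2 * K₀) ^ 2 * Real.exp (β * r) *
            Real.exp ((β * K₀ + n * ε M) * r * Real.exp (β * K₀ * r))) *
            (256 * |U| * (L : ℝ) ^ 2 * (1 + 2 * K₀) / r) ^ n) := by
          gcongr
      _ = D * (Real.exp (ε M * A) * (256 * |U| * (L : ℝ) ^ 2 * (1 + 2 * K₀) / r)) ^ n := by
          rw [hsplit, hD, mul_pow]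
          field_simp
      _ ≤ D * (3 / 4 : ℝ) ^ n := by
          gcongr
          calc Real.exp (ε M * A) * (256 * |U| * (L : ℝ) ^ 2 * (1 + 2 * K₀) / r) ≤ (3 / 2) * (1 / 2) :=
                mul_le_mul hexp hratio hratio0 (by norm_num)
            _ = 3 / 4 := by norm_num

/-- **The two-point bridge for every coupling**: for `L ≥ 3`, `β > 0` and every real `U`,
`∫dμ_{C_M} ψ⁺_{(x⃗ₑ,0)σ} ψ⁻_{(y⃗ₑ,0)σ'} e^{−V_M(U)} ⟶ e^{−βUL²/4}·(Tr(e^{−βH'}c†_{x⃗ₑσ}c_{y⃗ₑσ'}) − ½[σ=σ'][x⃗ₑ=y⃗ₑ]Tr e^{−βH'})/Tr e^{−βH₀}`,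
`H' = hubbardTorusWith 2 L 1 U (μ + U/2)`, `H₀ = hubbardTorusWith 2 L 1 0 μ` (via `hasSum_twoPointLimitDet_series`). -/
theorem tendsto_gaussExpect_twoPoint_eq_trace_div_allU (hL : 3 ≤ L) {β : ℝ} (hβ : 0 < β) (μ U : ℝ) (σ σ' : Fin 2)
    (xe ye : TorusSite 2 L) :
    Tendsto (fun M : ℕ => gaussExpect ℂ (hubbardCovariance L M β μ 0)
        (positionField L M β 0 σ xe 0 * positionField L M β 1 σ' ye 0 * grassmannExp (-(hubbardInteraction L M β U))))
      atTop
      (𝓝 ((Real.exp (-(β * U / 4 * (L : ℝ) ^ 2)) : ℂ) *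
        ((Matrix.gibbsWeight β (hubbardTorusWith 2 L 1 U (μ + U / 2)) *
            (creation (orb (FermionTorus.ofTorusSite xe) σ) * annihilation (orb (FermionTorus.ofTorusSite ye) σ'))).trace -
          (if σ = σ' ∧ xe = ye then (1 / 2 : ℂ) else 0) * Matrix.partitionFn β (hubbardTorusWith 2 L 1 U (μ + U / 2))) /
        Matrix.partitionFn β (hubbardTorusWith 2 L 1 0 μ))) := by
  rw [← (hasSum_twoPointLimitDet_series hL hβ μ U σ σ' xe ye).tsum_eq]
  exact tendsto_gaussExpect_twoPoint_mul_grassmannExp_allU hβ μ U σ σ' xe ye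

/-- **The normalised Grassmann two-point function converges to the Hamiltonian one minus `½δ`, for every coupling**:
for `L ≥ 3`, `β > 0` and every real `U`,
`∫dμ_{C_M}ψ⁺_{(x⃗ₑ,0)σ}ψ⁻_{(y⃗ₑ,0)σ'}e^{−V} / ∫dμ_{C_M}e^{−V} ⟶ Tr(e^{−βH'}c†_{x⃗ₑσ}c_{y⃗ₑσ'})/Tr e^{−βH'} − ½[σ=σ'][x⃗ₑ=y⃗ₑ]`,
`H' = hubbardTorusWith 2 L 1 U (μ + U/2)` (the tree's `tendsto_gaussExpect_twoPoint_div_effPartitionFn` without `hU`). -/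
theorem tendsto_gaussExpect_twoPoint_div_effPartitionFn_allU (hL : 3 ≤ L) {β : ℝ} (hβ : 0 < β) (μ U : ℝ)
    (σ σ' : Fin 2) (xe ye : TorusSite 2 L) :
    Tendsto (fun M : ℕ => gaussExpect ℂ (hubbardCovariance L M β μ 0)
        (positionField L M β 0 σ xe 0 * positionField L M β 1 σ' ye 0 * grassmannExp (-(hubbardInteraction L M β U))) /
        effPartitionFn ℂ (hubbardCovariance L M β μ 0) (hubbardInteraction L M β U)) atTop
      (𝓝 ((Matrix.gibbsWeight β (hubbardTorusWith 2 L 1 U (μ + U / 2)) *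
            (creation (orb (FermionTorus.ofTorusSite xe) σ) * annihilation (orb (FermionTorus.ofTorusSite ye) σ'))).trace /
          Matrix.partitionFn β (hubbardTorusWith 2 L 1 U (μ + U / 2)) -
        (if σ = σ' ∧ xe = ye then (1 / 2 : ℂ) else 0))) := by
  haveI : Nonempty (Finset (Orb (FermionTorus 2 L))) := ⟨∅⟩
  have hZ' : Matrix.partitionFn β (hubbardTorusWith 2 L 1 U (μ + U / 2)) ≠ 0 :=
    (Matrix.partitionFn_pos β (isHermitian_hamiltonianWith (fermionTorusGraph 2 L) 1 U (μ + U / 2))).ne'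
  have hZ₀ : Matrix.partitionFn β (hubbardTorusWith 2 L 1 0 μ) ≠ 0 :=
    (Matrix.partitionFn_pos β (isHermitian_hamiltonianWith (fermionTorusGraph 2 L) 1 0 μ)).ne'
  have he : ((Real.exp (-(β * U / 4 * (L : ℝ) ^ 2)) : ℝ) : ℂ) ≠ 0 := by exact_mod_cast (Real.exp_pos _).ne'
  have hden : ((Real.exp (-(β * U / 4 * (L : ℝ) ^ 2)) : ℝ) : ℂ) * Matrix.partitionFn β (hubbardTorusWith 2 L 1 U (μ + U / 2)) /
      Matrix.partitionFn β (hubbardTorusWith 2 L 1 0 μ) ≠ 0 :=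
    div_ne_zero (mul_ne_zero he hZ') hZ₀
  have key := (tendsto_gaussExpect_twoPoint_eq_trace_div_allU hL hβ μ U σ σ' xe ye).div
    (tendsto_effPartitionFn_hubbard_eq_partitionFn_div_allU hL hβ μ U) hden
  set T : ℂ := (Matrix.gibbsWeight β (hubbardTorusWith 2 L 1 U (μ + U / 2)) *
    (creation (orb (FermionTorus.ofTorusSite xe) σ) * annihilation (orb (FermionTorus.ofTorusSite ye) σ'))).trace with hT
  set Z' : ℂ := Matrix.partitionFn β (hubbardTorusWith 2 L 1 U (μ + U / 2)) with hZ'def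
  set Z₀ : ℂ := Matrix.partitionFn β (hubbardTorusWith 2 L 1 0 μ) with hZ₀def
  set e : ℂ := ((Real.exp (-(β * U / 4 * (L : ℝ) ^ 2)) : ℝ) : ℂ) with hedef
  set corr : ℂ := (if σ = σ' ∧ xe = ye then (1 / 2 : ℂ) else 0) with hcorr
  have hlim : e * (T - corr * Z') / Z₀ / (e * Z' / Z₀) = T / Z' - corr := by
    field_simp
  rw [← hlim]
  exact key

/-- **THE SUPPLIER THEOREM (`stub_asm_matsubara`): the engine's Grassmann two-point function and the Hubbard thermal
two-point function of `bgm_two_point_limit`, FOR EVERY COUPLING.**  For `L ≥ 3`, `β > 0`, every real `U` and `μ`, and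
lattice sites `x, y ∈ ℤ²` (projected to the torus, `x̄ = Torus.proj L x`):
`∫dμ_{C_M}ψ⁺_{(x̄,0)σ}ψ⁻_{(ȳ,0)σ'}e^{−V_M(U)} / ∫dμ_{C_M}e^{−V_M(U)} ⟶ hubbardThermalTwoPoint β U (μ + U/2) L x y σ σ' − ½[σ=σ'][x̄=ȳ]`
as `M → ∞` — literally the tree's `tendsto_grassmannTwoPoint_eq_hubbardThermalTwoPoint_sub` with its hypothesis
`3e|U|L²βB² < 1` removed (constants depend on `(L, β)`; only `M`-uniformity matters). -/
theorem tendsto_grassmannTwoPoint_eq_hubbardThermalTwoPoint_sub_allU (hL : 3 ≤ L) {β : ℝ} (hβ : 0 < β) (μ U : ℝ)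
    (σ σ' : Fin 2) (x y : Site 2) :
    Tendsto (fun M : ℕ => gaussExpect ℂ (hubbardCovariance L M β μ 0)
        (positionField L M β 0 σ (Torus.proj L x) 0 * positionField L M β 1 σ' (Torus.proj L y) 0 *
          grassmannExp (-(hubbardInteraction L M β U))) /
        effPartitionFn ℂ (hubbardCovariance L M β μ 0) (hubbardInteraction L M β U)) atTop
      (𝓝 (hubbardThermalTwoPoint β U (μ + U / 2) L x y σ σ' -
        (if σ = σ' ∧ Torus.proj L x = Torus.proj L y then (1 / 2 : ℂ) else 0))) := by
  have hval : hubbardThermalTwoPoint β U (μ + U / 2) L x y σ σ' =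
      (Matrix.gibbsWeight β (hubbardTorusWith 2 L 1 U (μ + U / 2)) *
          (creation (orb (FermionTorus.ofTorusSite (Torus.proj L x)) σ) *
            annihilation (orb (FermionTorus.ofTorusSite (Torus.proj L y)) σ'))).trace /
        Matrix.partitionFn β (hubbardTorusWith 2 L 1 U (μ + U / 2)) := by
    rw [hubbardThermalTwoPoint, dif_neg (NeZero.ne L), Matrix.thermalCorr, Matrix.gibbsState_apply]
    exact (div_eq_inv_mul _ _).symm
  rw [hval]
  exact tendsto_gaussExpect_twoPoint_div_effPartitionFn_allU hL hβ μ U σ σ' (Torus.proj L x) (Torus.proj L y)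

end

end Summit.HubbardSuperconductivity.HubbardSuperconductivity.Theorems.MatsubaraAllU
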